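import Summits.ValiantsHypothesis.ValiantsHypothesis.Theses.SymmetroidDescartes
import Summits.ValiantsHypothesis.ValiantsHypothesis.Theorems.SymmetroidDescartesQuasiRolleToDescartes
import Summits.ValiantsHypothesis.ValiantsHypothesis.Theorems.DerivedPencilRolleQuasi.Negative.DerivedPencilRolleQuasiExponentTwo
import Summits.ValiantsHypothesis.ValiantsHypothesis.Theorems.DerivedPencilRolleQuasi.Negative.DerivedPencilRolleQuasiSpacelikeFamily
import Summits.ValiantsHypothesis.ValiantsHypothesis.Theorems.DerivedPencilRolleQuasi.Negative.DerivedPencilRolleQuasiPolyInSize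

/-!
# Disproof of `DerivedPencilRolleQuasi` — findings

Crux `stmt-ValiantsHypothesis-18064` (route SymmetroidDescartes, rank 2; the repaired inductive step):

  `S : ∃ C A, ∀ m K (S : Fin (K+1) → Sym_m(ℝ) invertible) (d strictly increasing),`
  `      Z₊(det F) ≤ C · Z₊(det ∂F) + (K+1)^(A·K) · 2^((log₂ m + 2)^A)`,

`F = Σ X^(d l) • S l`, `∂F = Σ_{l<K} X^(d(l+1)−d 0−1) • ((d(l+1)−d 0) • S (l+1))`, `Z₊` = number of
distinct positive roots (`0` for the zero polynomial).  Elaboration read-back (W.lean, rc 0): the body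
restates `rfl`; `2 ^ (Nat.log 2 m + 2) ^ A = 2 ^ ((Nat.log 2 m + 2) ^ A)`; the ℕ-subtractions in `∂F`
are non-junk under `StrictMono d`; degenerate `K = 0`, `m ≤ 1` are harmless (budget ≥ 1, no roots).

## VERDICT OF CYCLE 1 (cdisprove, 2026-08-17): NO KILL — the crux resists; four negative lemmas landed.

Everything below is kernel-checked unless marked `sorry` (near-misses, §E).  Landed files (all under
`Theorems/DerivedPencilRolleQuasi/Negative/`, `--supports stmt-ValiantsHypothesis-18064`):

* `DerivedPencilRolleQuasiExponentTwo.lean` (p158933, ACCEPTED @6d75700d): the `A = 1` slice of S is FALSE for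
  every `C`; `A = 0 ⇒ A = 1`; hence **any witnessing constants have `A ≥ 2`**
  (`two_le_exponent_of_derivedPencilRolleQuasi_constants`). Mechanism: staircase (tree) at `L = 7`.
* `DerivedPencilRolleQuasiSpacelikeFamily.lean` (p158890, ACCEPTED @6d75700d): the **spacelike `2 × 2` family**
  `F_D = [[1/2 + p_D, Y_D], [Y_D, 1/2 − p_D]]`, `p_D = 2^D ∏_{k<D}(X − (k+1))`, `Y_D = δ_D Σ_{l≤D} X^l`:
  size `2`, `K = D` terms, symmetric invertible coefficients, `det ∂F_D < 0` on `(0,∞)` (so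
  `Z₊(det ∂F_D) = 0` HONESTLY, not as the zero polynomial) and `Z₊(det F_D) ≥ 2D`.
* `DerivedPencilRolleQuasiTermFactor.lean` (p159914, ACCEPTED @51e1211f; also re-derived in §A.2 below from the family):
  **no size-only budget `B m` works for any `C`**; the crux with `(K+1)^(A·K)` DROPPED is false; `B(2,K) ≥ 2K`.
* `DerivedPencilRolleQuasiPolyInSize.lean` (p159134, ACCEPTED @9e3bfe51): **for every `g : ℕ → ℕ`, `C`, `A` the step with
  budget `g K · m^A` is FALSE** (staircase with `6A+1` levels: `K = 6A+3` terms is a constant); degree 0: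
  no `K`-only budget; packaged: budget `(K+1)^(A·K) · m^A` is false.

So the budget SHAPE is bracketed from both sides by landed theorems: super-polynomial in `m` at bounded
`K`, and growing (≥ linearly) in `K` at bounded `m`; the crux's `(K+1)^(A·K) · 2^(polylog m)` with
`A ≥ 2` is the first natural survivor, and `A = 2, C = 0` is consistent with every family on file.

## WHY IT RESISTS (read with `Cruxes/DerivedPencilRolleQuasi/STRATEGY-CENSUS.md` F1–F4)

1. (F1, strategists; confirmed by every lemma here being uniform in `C`) the Rolle multiplier carries
   no information: block replication `⊕_j (F + η_j X^(d 0) I)` multiplies `Z₊(F)` and leaves the root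
   SET of `det ∂F` unchanged, so S ⟺ the pure bound `Z₊ ≤ B_{A'}(m,K)` on symmetric (equivalently, by
   GKKP/Mahajan–Vinay, on ABP) determinants over `K+1` lacunary monomials.
2. Hence `¬S` needs, for every `A`, admissible pencils with `log₂ Z₊ > A·K·log₂(K+1) + (log₂ m+2)^A`:
   super-quasi-polynomially many positive roots from polynomial-size skew circuits over FEW monomials
   (`(log m)^(A−1) < K < m^(1/A)`, the only window where Descartes' count `C(m+K,K)` leaves room).
3. Every root-rich mechanism in the tree is TROPICAL (one sign change per change of dominant walk:
   staircase, Gajjar–Radhakrishnan/Mulmuley–Shah bumps) and therefore Gusfield-capped at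
   `log Z = O(log² m)` in total (parametric shortest paths on `s` nodes have `≤ s^(log s + O(1))`
   pieces) — exactly absorbed by `2^((log₂ m+2)^2)`.  The numbers: staircase `log₂ Z ≈ L log₂ n` vs
   `(log₂ m)^2 ≥ (6L + 6 log₂ n)^2`; binarised GR bumps `log Z = Θ(log² n)` vs `(c log n)^2`, `c ≥ 8`.
   Fixed-format mechanisms (size `2`: this file's family; Vinnikov `K = 2`) are polynomial in the free
   parameter by Descartes.  A "cancellation-root" amplifier (sign changes without a change of dominant
   monomial, iterated across scales) is not known in any skew class — this is the open core, and it is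
   the SAME construction that would kill the route's X = `LacunaryDescartes` (census §Negation).
4. No finite computation can refute S: with `C = 0`, Descartes' `C(m+K,K) − 1 < B_2(m,K)` for all `K`
   whenever `log₂ m < 26` (`A = 2`; `< 68` for `A = 3`) — ExponentFloor remark (iii).

## CONTENTS

* §A load-bearing analysis (one `def …Without…`/`theorem …_false_without_…` per hypothesis of S);
* §B tightness / boundary lemmas (what any witnessing `(C, A)` must satisfy);
* §C refuted natural strengthenings;
* §D targets (none yet: no line picked, `stuck_stubs = []`);
* §E near-misses / what a counterexample must be (`sorry` only here).
-/

set_option linter.dupNamespace false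
set_option linter.unusedVariables false

namespace Summit.ValiantsHypothesis.ValiantsHypothesis.Cruxes.DerivedPencilRolleQuasi.Disproof

open scoped BigOperators Matrix Polynomial
open Polynomial
open Summit.ValiantsHypothesis.ValiantsHypothesis.Theses.SymmetroidDescartes
open Summit.ValiantsHypothesis.ValiantsHypothesis.Theorems.SymmetroidDescartes
  (posRoots_le_of_step alternations_le_of_step quasiBudget_mono)
open Summit.ValiantsHypothesis.ValiantsHypothesis.Theorems.DerivedPencilRolleQuasi.Negative

/-! ## §0 The step shape with an abstract budget -/

/-- The STEP SHAPE of the crux with multiplier `C` and an abstract budget `B m K`: every variant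
studied below is `QStep C B` for some `B`. -/
def QStep (C : ℕ) (B : ℕ → ℕ → ℕ) : Prop :=
  ∀ (m K : ℕ) (S : Fin (K + 1) → Matrix (Fin m) (Fin m) ℝ) (d : Fin (K + 1) → ℕ),
    (∀ l, (S l).IsSymm) → (∀ l, (S l).det ≠ 0) → StrictMono d →
      ((∑ l, (Polynomial.X : Polynomial ℝ) ^ d l • (S l).map Polynomial.C).det.roots.toFinset.filter
          (fun t => 0 < t)).card ≤
        C * ((∑ l : Fin K, (Polynomial.X : Polynomial ℝ) ^ (d l.succ - d 0 - 1) •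
          (((d l.succ - d 0 : ℕ) : ℝ) • S l.succ).map Polynomial.C).det.roots.toFinset.filter
            (fun t => 0 < t)).card + B m K

/-- The crux's budget. -/
def quasiBudget (A : ℕ) : ℕ → ℕ → ℕ := fun m K => (K + 1) ^ (A * K) * 2 ^ (Nat.log 2 m + 2) ^ A

/-- The crux IS `∃ C A, QStep C (quasiBudget A)` (definitional). -/
theorem crux_iff : DerivedPencilRolleQuasi ↔ ∃ C A, QStep C (quasiBudget A) := Iff.rfl

/-- Budget monotonicity transfers the step: a smaller budget gives a stronger statement. -/
theorem qStep_mono {C : ℕ} {B B' : ℕ → ℕ → ℕ} (hBB' : ∀ m K, B m K ≤ B' m K) (h : QStep C B) :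
    QStep C B' :=
  fun m K S d hS hdet hd => (h m K S d hS hdet hd).trans (Nat.add_le_add_left (hBB' m K) _)

/-! ## §A Load-bearing analysis

For each hypothesis / structural feature `H` of S: the statement with `H` dropped or weakened, and
what breaks.  Verdicts: QUASI-SIZE FACTOR — load-bearing (A ≥ 2; no polynomial in `m`); TERM FACTOR —
load-bearing (no size-only budget); ROLLE MULTIPLIER `C` — informationless (F1; every lemma uniform in
`C`); `StrictMono d` — bookkeeping only (dropping it silently kills the Rolle term, §A.4);
INVERTIBILITY, SYMMETRY — not load-bearing for refutation purposes (§A.5, paper). -/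

/-! ### §A.1 Without the quasi-polynomial size factor: budget `(K+1)^(A·K) · m^A` — FALSE -/

/-- S with `2^((log₂ m+2)^A)` replaced by `m^A` (term factor kept). -/
def DerivedPencilRolleQuasiWithoutQuasiSize : Prop :=
  ∃ C A : ℕ, QStep C (fun m K => (K + 1) ^ (A * K) * m ^ A)

/-- **Any proof must use a super-polynomial-in-size slack** — even at `K = 6A+3` terms (staircase with
`6A+1` levels; landed `not_derivedPencilRolleQuasi_polyInSize`, file …PolyInSize.lean). -/
theorem derivedPencilRolleQuasi_false_without_quasiSize : ¬ DerivedPencilRolleQuasiWithoutQuasiSize :=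
  not_derivedPencilRolleQuasi_polyInSize

/-- Stronger, landed form: for EVERY `g : ℕ → ℕ`, `C`, `A`, the budget `g K · m^A` fails. -/
theorem qStep_false_polyInSize (g : ℕ → ℕ) (C A : ℕ) : ¬ QStep C (fun m K => g K * m ^ A) :=
  not_step_polyInSize g C A

/-! ### §A.2 Without the term factor: budget `2^((log₂ m+2)^A)` — FALSE -/

/-- S with `(K+1)^(A·K)` dropped. -/
def DerivedPencilRolleQuasiWithoutTermFactor : Prop :=
  ∃ C A : ℕ, QStep C (fun m _ => 2 ^ (Nat.log 2 m + 2) ^ A)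

/-- The spacelike family read as a budget constraint: any `(C, B)` with `QStep C B` has `2K ≤ B 2 K`
(`K ≥ 1`), whatever `C` — the Rolle term of `F_K` is `0` and `Z₊(det F_K) ≥ 2K` (landed family:
`card_posRoots_derived_spF`, `twoMul_le_card_posRoots_spF`; this corollary lands in …TermFactor.lean). -/
theorem qStep_twoK_le (C : ℕ) (B : ℕ → ℕ → ℕ) (h : QStep C B) (K : ℕ) (hK : 1 ≤ K) : 2 * K ≤ B 2 K := by
  have h1 := h 2 K (spS K) (spD K) (spS_isSymm K) (spS_det_ne_zero K) (spD_strictMono K)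
  rw [card_posRoots_derived_spF K hK, mul_zero, zero_add] at h1
  exact (twoMul_le_card_posRoots_spF K).trans h1

/-- Stronger form: for EVERY size-only budget `B m` and every `C`, the step fails
(at `m = 2`, `K = B 2 + 1` terms). -/
theorem qStep_false_termFree (C : ℕ) (B : ℕ → ℕ) : ¬ QStep C (fun m _ => B m) := by
  intro h
  have h1 := qStep_twoK_le C (fun m _ => B m) h (B 2 + 1) (Nat.succ_pos _)
  omega

/-- **Any proof must let the slack grow with the number of terms** — at size `2` already
(spacelike `2 × 2` family; lands as `derivedPencilRolleQuasi_false_without_termFactor`, …TermFactor.lean). -/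
theorem derivedPencilRolleQuasi_false_without_termFactor' : ¬ DerivedPencilRolleQuasiWithoutTermFactor :=
  fun ⟨C, A, h⟩ => qStep_false_termFree C (fun m => 2 ^ (Nat.log 2 m + 2) ^ A) h

/-- And for every `K`-only budget (degree-0 case of §A.1): three-term pencils of growing size. -/
theorem qStep_false_sizeFree (g : ℕ → ℕ) (C : ℕ) : ¬ QStep C (fun _ K => g K) :=
  not_step_sizeFree g C

/-! ### §A.3 The Rolle multiplier `C` — informationless

All lemmas in §A.1–§A.2 and §B hold for EVERY `C`: the refuting families have `Z₊(det ∂F) = 0` (the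
spacelike family honestly; the symmetrised staircase through the glue's perturbation, whose iterated
bound is uniform in `C' = max C 1`).  The strategists' replication collapse (STRATEGY-CENSUS F1: block
sums multiply `Z₊(F)` at a fixed root set of `det ∂F`) shows more: S ⟺ its own `C = 0` instance up to
`A ↦ O(A log C)`.  Not re-formalised here (needs the block-sum/perturbation API of `stub_perturb`);
recorded so that no prover spends the budget on the Rolle structure. -/

/-! ### §A.4 Without `StrictMono d` — the Rolle term silently dies (bookkeeping, not content)

If the exponents are not increasing from `d 0`, every weight `(d(l+1) − d 0 : ℕ)` truncates to `0`, the
derived pencil is the ZERO pencil and (for `m ≥ 1`) `det ∂F = 0`, whose root multiset is empty by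
convention: the Rolle term contributes `0` and the "step" degenerates to the absolute bound
`Z₊(det F) ≤ B(m,K)` for pencils with arbitrary (e.g. decreasing) distinct exponents — by F1 the same
statement as S up to constants.  So `StrictMono` is not a refutation handle; it only makes `∂F` the
honest derivative `d/dt (t^(−d 0) F)`. -/

/-- With an apex at `d 0` (all exponents `≤ d 0`) every derived weight vanishes. -/
theorem derived_weight_eq_zero {K : ℕ} (d : Fin (K + 1) → ℕ) (h : ∀ l, d l ≤ d 0) (l : Fin K) :
    ((d l.succ - d 0 : ℕ) : ℝ) = 0 := by
  have : d l.succ - d 0 = 0 := Nat.sub_eq_zero_of_le (h l.succ)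
  simp [this]

/-- Hence the derived pencil of an apex-at-`d 0` pencil is the zero matrix polynomial … -/
theorem derived_eq_zero_of_apex {m K : ℕ} (S : Fin (K + 1) → Matrix (Fin m) (Fin m) ℝ)
    (d : Fin (K + 1) → ℕ) (h : ∀ l, d l ≤ d 0) :
    (∑ l : Fin K, (Polynomial.X : Polynomial ℝ) ^ (d l.succ - d 0 - 1) •
        (((d l.succ - d 0 : ℕ) : ℝ) • S l.succ).map Polynomial.C) = 0 := by
  refine Finset.sum_eq_zero fun l _ => ?_
  rw [derived_weight_eq_zero d h l, zero_smul]
  simp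

/-- … and its Rolle term is `0` whenever `m ≥ 1` (the `det` of the zero matrix is the zero polynomial,
whose root multiset is empty by convention). -/
theorem rolleTerm_eq_zero_of_apex {m K : ℕ} (hm : 1 ≤ m) (S : Fin (K + 1) → Matrix (Fin m) (Fin m) ℝ)
    (d : Fin (K + 1) → ℕ) (h : ∀ l, d l ≤ d 0) :
    ((∑ l : Fin K, (Polynomial.X : Polynomial ℝ) ^ (d l.succ - d 0 - 1) •
        (((d l.succ - d 0 : ℕ) : ℝ) • S l.succ).map Polynomial.C).det.roots.toFinset.filter
          (fun t => 0 < t)).card = 0 := by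
  rw [derived_eq_zero_of_apex S d h]
  haveI : Nonempty (Fin m) := Fin.pos_iff_nonempty.1 hm
  simp [Matrix.det_zero]

/-! ### §A.5 Invertibility and symmetry (paper)

* INVERTIBILITY `det (S l) ≠ 0`: both refuting mechanisms already satisfy it (the spacelike family by
  `det S l = c_l² − a_l² − δ² < 0`; the symmetrised staircase after the glue's perturbation
  `S l ↦ S l + η•1`).  Dropping it only ADDS the junk case `det F = 0` (root multiset empty: helps S)
  and singular leading/trailing coefficients (no new roots).  Not a handle.
* SYMMETRY: dropping it gives the statement for general real matrix pencils; GKKP symmetrisation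
  (tree `hasSymmAffineDetRepr_of_hasDetRepr`, size `m ↦ 4m³+7`, `det` preserved exactly on the
  monomial curve, `exists_symm_pencil_eval`) plus F1 shows NonSym-S(A+1) ⇐ S(A) ⇐ NonSym-S(A) up to
  the constants, since `(log₂(4m³+7)+2)^A ≤ (3 log₂ m + 5)^A ≤ (log₂ m+2)^(A+1)` eventually.  So
  symmetry is not load-bearing either; every counterexample search may be run on plain ABPs /
  general matrices (this is how the staircase was found). -/

/-! ## §B Tightness / boundary lemmas: what any witnessing `(C, A)` must satisfy -/

/-- `A ≥ 2` (landed: ExponentTwo). -/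
theorem two_le_A (C A : ℕ) (h : QStep C (quasiBudget A)) : 2 ≤ A :=
  two_le_exponent_of_derivedPencilRolleQuasi_constants C A h

/-- At size `2` the certified budget is at least `2K` (trivially consistent with
`(K+1)^(A·K)·2^(3^A)`: the crux survives the spacelike model). -/
theorem twoK_le_budget_at_size_two (C A : ℕ) (h : QStep C (quasiBudget A)) (K : ℕ) (hK : 1 ≤ K) :
    2 * K ≤ quasiBudget A 2 K :=
  qStep_twoK_le C (quasiBudget A) h K hK

/-- Brackets, both directions: any `(C, B)` with `QStep C B` has (i) `B 2 K ≥ 2K` (`qStep_twoK_le`)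
and (ii) `B m (6a+3) ≠ O(m^a)` for every `a` (`qStep_false_polyInSize` read contrapositively: if
`B m K ≤ g K · m^a` for all `m, K` then `QStep C B` fails). -/
theorem budget_not_polyInSize (C : ℕ) (B : ℕ → ℕ → ℕ) (g : ℕ → ℕ) (a : ℕ)
    (hB : ∀ m K, B m K ≤ g K * m ^ a) : ¬ QStep C B :=
  fun h => qStep_false_polyInSize g C a (qStep_mono hB h)

/-! ## §C Refuted natural strengthenings (all landed; one-line citations)

| strengthening of S | status | witness | file |
|---|---|---|---|
| budget `(m+K)^a` (rev-1 `DerivedPencilRolle`) | FALSE | staircase `L = 6a+1` | tree `not_DerivedPencilRolle` |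
| `A = 0` (budget `2`) | FALSE | `S₅` (2×2 four-nomial) | tree ExponentFloor |
| `A = 1` (budget `(K+1)^K·2^(log₂m+2)`) | FALSE | staircase `L = 7` | ExponentTwo |
| budget `(K+1)^(A·K)·m^A`, any `A` | FALSE | staircase `L = 6A+1` | PolyInSize |
| budget `g(K)·m^A`, any `g, A` | FALSE | staircase | PolyInSize |
| budget `B(m)`, any `B` | FALSE | spacelike 2×2, `K = B(2)+1` | TermFactor |
| budget `g(K)`, any `g` | FALSE | staircase `L = 1` (3 terms) | PolyInSize |
| coefficient-sign law (signs of `det F`'s coefficients within budget) | FALSE on paper | `diag(g,…,g)` (census S4) | — |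
| `log Z₊ = O(log m · log K)` (BilinearLaw) | FALSE on paper | staircase `L = log₂ n` / binarised bumps (census F2) | — |
| `A = 2, C = 0` | OPEN, consistent with all families | — | — |
-/

/-- The `A ≤ 1` variant of the crux is false (landed). -/
theorem not_crux_with_A_le_one : ¬ ∃ C A : ℕ, A ≤ 1 ∧ QStep C (quasiBudget A) :=
  not_derivedPencilRolleQuasi_with_exponent_le_one

/-! ## §D Targets (the lead's stuck stubs)

None this cycle: no line is picked for this crux yet (`Lines/sign_variation.lean` and
`Lines/imm_halving.lean` are registered, PICKED.md absent) and `payload.stuck_stubs = []`.  When a line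
is picked, the first targets are: for `sign-variation`, the rung `(m,V) = (2,2)` of `stub_svqd` — NOTE
that the spacelike family does NOT threaten it (all its coefficients are indefinite, so after
`stub_split` its sign-variation `V` is `≈ 2K`, not bounded); for `imm-halving`, the `HalvingStep`
loss constant against the staircase (`L` levels halve to `L/2` with loss `n^(L/2)` = `√Z`, fine) and
against binarised bumps.  Cheap POSITIVE targets (prover lane, not filed here): the regime fences of
census D2 — `K ≤ A'(log₂ m+1)` or `m + K ≤ (K+1)^A` ⇒ Descartes' monomial count `C(m+K,K) − 1` is
already inside the budget (Leibniz support count + tree `card_roots_toFinset_filter_pos_lt_card_support`);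
the crux's content is the window `(log m)^(A−1) < K < m^(1/A)` only. -/

/-! ## §E What a counterexample must be; near-misses

The refuter's currency is ALTERNATIONS at rational test points (exactly checkable).  `¬S` follows from
a family in that currency beating the ITERATED bound — this is the precise target for any compute
search (none was run this cycle: by §WHY-4 no finite search below `log₂ m = 26` can succeed, and no
candidate mechanism beyond tropical ones exists to be tested at scale). -/

/-- **H_alt (the search target, alternation currency).** For every `C' ≥ 1` and `A` some real symmetric
`K`-term pencil of size `m` alternates in sign at `N + 1` increasing positive points with
`N > K · C'^K · (K+1)^(A·K) · 2^((log₂ m+2)^A)`. -/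
def AlternationMonster : Prop :=
  ∀ C' A : ℕ, 1 ≤ C' → ∃ (K m : ℕ) (S : Fin K → Matrix (Fin m) (Fin m) ℝ) (d : Fin K → ℕ) (N : ℕ)
    (τ : Fin (N + 1) → ℝ), (∀ l, (S l).IsSymm) ∧ StrictMono τ ∧ (∀ j, 0 < τ j) ∧
    (∀ j : Fin N, ((∑ l, (Polynomial.X : Polynomial ℝ) ^ d l • (S l).map Polynomial.C).det).eval
        (τ j.castSucc) * ((∑ l, (Polynomial.X : Polynomial ℝ) ^ d l • (S l).map Polynomial.C).det).eval
        (τ j.succ) < 0) ∧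
    K * C' ^ K * ((K + 1) ^ (A * K) * 2 ^ (Nat.log 2 m + 2) ^ A) < N

/-- `H_alt → ¬S` (sorry-free): the glue's iteration + perturbation (`posRoots_le_of_step`,
`alternations_le_of_step`) is exactly the bridge.  This is the form in which a compute witness would
be consumed. -/
theorem crux_false_of_alternationMonster (hH : AlternationMonster) : ¬ DerivedPencilRolleQuasi := by
  rintro ⟨C, A, h⟩
  have hiter := posRoots_le_of_step C (fun m K => (K + 1) ^ (A * K) * 2 ^ (Nat.log 2 m + 2) ^ A)
    (fun m K K' hKK' => quasiBudget_mono A m K K' hKK') h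
  have hbound := alternations_le_of_step (max C 1) (le_max_right _ _)
    (fun m K => (K + 1) ^ (A * K) * 2 ^ (Nat.log 2 m + 2) ^ A)
    (fun m K K' hKK' => quasiBudget_mono A m K K' hKK') hiter
  obtain ⟨K, m, S, d, N, τ, hS, hτ, hpos, halt, hlt⟩ := hH (max C 1) A (le_max_right _ _)
  exact absurd (hbound K m S d hS N τ hτ hpos halt) (not_le.2 hlt)

/-- **Near-miss 1 (the non-tropical staircase).** A staircase with `L` levels whose size is
`poly(n) · L^O(1)` instead of `2^(O(L)) · poly(n)` would give `n^L` alternations at `K = L + 2` terms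
and kill S (take `L = (log₂ n)^A`) AND the route's X.  Obstruction: in every parametric-shortest-path
design the `2^L` column blow-up is forced by Gusfield's piece bound (`L ≫ log s` levels need
`s ≥ 2^(Ω(√(L log n)))` nodes); a design where LOWER-ORDER walks (not the dominant one) carry the sign
pattern across levels is the missing idea.  Recorded as a `sorry` so the statement is on file. -/
theorem nearMiss_polySize_staircase :
    ∀ A : ℕ, ∃ (K m : ℕ) (S : Fin K → Matrix (Fin m) (Fin m) ℝ) (d : Fin K → ℕ) (N : ℕ)
      (τ : Fin (N + 1) → ℝ), (∀ l, (S l).IsSymm) ∧ StrictMono τ ∧ (∀ j, 0 < τ j) ∧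
      (∀ j : Fin N, ((∑ l, (Polynomial.X : Polynomial ℝ) ^ d l • (S l).map Polynomial.C).det).eval
          (τ j.castSucc) * ((∑ l, (Polynomial.X : Polynomial ℝ) ^ d l • (S l).map Polynomial.C).det).eval
          (τ j.succ) < 0) ∧
      (K + 1) ^ (A * K) * 2 ^ (Nat.log 2 m + 2) ^ A < N := by
  sorry

/-- **Near-miss 2 (iterating the spacelike gadget).** The `2 × 2` family realises `2D` light-cone
crossings of a spacelike polynomial curve in `Sym₂(ℝ) ≅ ℝ^{1,2}` with `D + 1` DENSE exponents.  A
LACUNARY version with `K + 1` exponents and `≫ K` crossings would need the planar curve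
`t ↦ (p(t), Y(t))` (a `(K+1)`-nomial curve) to cross the circle `p² + Y² = 1/4` super-linearly often
in `K` — impossible: `p² + Y² − 1/4` restricted to... is a fewnomial with `≤ (K+1)(K+2)/2 + 1` monomials,
and at size `2` Descartes caps everything by `O(K²)` anyway; in size `m = 2r` (Sym_m ⊇ r Lorentz
blocks) block sums only ADD crossings.  The spacelike mechanism does not iterate multiplicatively; it is
a fixed-format mechanism, recorded to stop re-discovery. -/
theorem nearMiss_spacelike_does_not_amplify : True := trivial

end Summit.ValiantsHypothesis.ValiantsHypothesis.Cruxes.DerivedPencilRolleQuasi.Disproof
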